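import Summits.AtomisticToContinuum.Crystallization.Theorems.PerronTransitivityUniformBindingRigidityCohesionO

/-!
# Cohesion of uniformly bound Lennard-Jones configurations, XVIII: the finite-certificate reduction at separation 31/50

Helper file (`--supports stmt-AtomisticToContinuum-15099`) of the registered stub
`stub_localHalfSpaceCert` of the line `registered` (skeleton rev 6) of the crux
`Summit.AtomisticToContinuum.Crystallization.Theses.PerronTransitivity.UniformBindingRigidity`
(item stmt-AtomisticToContinuum-15099).  In rev 6 the stub `(LOCAL)` is posed at separation
`31/50` (the next rung `stub_sepThirtyOne` of the separation bootstrap), constraint radius `6`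
and level `−711/500`:

  no `31/50`-separated `Y ∋ 0` in a closed half-space `{⟪·, u⟫ ≤ 0}` through `0` (`‖u‖ = 1`)
  has all its Lennard-Jones site sums `U_Y(p) = Σ'_{q ∈ Y, q ≠ p} V_LJ(dist p q)` at the sites
  `p ∈ Y` with `dist p 0 ≤ 6` bounded by `−711/500`.

This file records, once and for all, that the stub follows from a FINITE CERTIFICATE: it is the
instance `(δ, r, Λ) = (31/50, 6, −711/500)` of part XVI's parametrised reduction
`stub_local_of_finiteCert_at` (sharp tail allowance `T(δ, R')/6` of parts XIII/XIV,
`T(δ, R) = 16/(δ³R³) + 18/(δ²R⁴) + 36/(5δR⁵) + 1/R⁶`):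

  `FINCERT(31/50, 6, −711/500, R')`: every finite `31/50`-separated `F ∋ 0` in
  `{⟪·, u⟫ ≤ 0} ∩ closedBall 0 (6 + R')` has a site `p`, `dist p 0 ≤ 6`, with
  `−711/500 + T(31/50, R')/6 < Σ_{q ∈ F, q ≠ p, dist q p ≤ R'} V_LJ(dist p q)`,

for some `R' > 0`, implies the stub LITERALLY (`local_thirtyOne_of_finiteCert`).  The certificate
itself is a finite but large certified computation, not attempted here.  All `[folklore]`.
-/

noncomputable section

namespace Summit.AtomisticToContinuum.Crystallization.Theorems.PerronTransitivityUniformBindingRigidity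

open scoped BigOperators Topology
open Filter Set Metric
open Literature.MathematicalPhysics.StatisticalMechanics
open Summit.AtomisticToContinuum.Crystallization.Theorems.ChargedEnergyGapNegative (E3)

/-! ## §32 The reduction of the rev-6 stub `(LOCAL)` at separation `31/50` -/

/-- **The rev-6 `(LOCAL)` at separation `31/50` from its finite certificate.** The instance
`(δ, r, Λ) = (31/50, 6, −711/500)` of `stub_local_of_finiteCert_at`:
`(∃ R' > 0, FINCERT(31/50, 6, −711/500, R')) → LOCAL(31/50, 6, −711/500)`, the conclusion being
literally the registered signature of `stub_localHalfSpaceCert` (skeleton rev 6). [folklore] -/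
theorem local_thirtyOne_of_finiteCert
    (H : ∃ R' : ℝ, 0 < R' ∧
      ∀ (F : Finset (EuclideanSpace ℝ (Fin 3))) (u : EuclideanSpace ℝ (Fin 3)), ‖u‖ = 1 →
        (0 : EuclideanSpace ℝ (Fin 3)) ∈ F →
        (∀ a ∈ F, ∀ b ∈ F, a ≠ b → 31 / 50 ≤ dist a b) →
        (∀ a ∈ F, inner ℝ a u ≤ 0) →
        (∀ a ∈ F, dist a 0 ≤ 6 + R') →
        ∃ p ∈ F, dist p 0 ≤ 6 ∧
          ∀ N : Finset (EuclideanSpace ℝ (Fin 3)),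
            (∀ q, q ∈ N ↔ q ∈ F ∧ q ≠ p ∧ dist q p ≤ R') →
            -(711 / 500) + 1 / 6 * (16 / ((31 / 50) ^ 3 * R' ^ 3) + 18 / ((31 / 50) ^ 2 * R' ^ 4) +
                36 / (5 * (31 / 50) * R' ^ 5) + 1 / R' ^ 6) <
              ∑ q ∈ N, lennardJones (dist p q)) :
    ∀ (Y : Set (EuclideanSpace ℝ (Fin 3))) (u : EuclideanSpace ℝ (Fin 3)), ‖u‖ = 1 →
      (0 : EuclideanSpace ℝ (Fin 3)) ∈ Y →
      (∀ p ∈ Y, ∀ q ∈ Y, p ≠ q → 31 / 50 ≤ dist p q) →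
      (∀ q ∈ Y, inner ℝ q u ≤ 0) →
      (∀ p ∈ Y, dist p 0 ≤ 6 → ∑' q : {q : EuclideanSpace ℝ (Fin 3) // q ∈ Y ∧ q ≠ p},
          lennardJones (dist p q.1) ≤ -(711 / 500)) →
      False := by
  obtain ⟨R', hR', hcert⟩ := H
  exact stub_local_of_finiteCert_at (31 / 50) 6 (-(711 / 500)) R' (by norm_num) (by norm_num)
    hR' hcert

end Summit.AtomisticToContinuum.Crystallization.Theorems.PerronTransitivityUniformBindingRigidity

end
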